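import Literature.RingTheory.FormalGroups.UniversalTypicalLaw
import Literature.RingTheory.FormalGroups.LazardComparisonLemma
import Mathlib.Algebra.MvPolynomial.Eval
import HarnessLib

/-!
# The universal `p`-typical law `F_V`: truncations and the `V_k`-linear term in degree `p^{k+1}`
# ([Hazewinkel 1978] §15.2, (15.2.4)–(15.2.6); [Lazard 1955] Lemme 3 for the polynomial `C_n`)

Topic `Literature/RingTheory/FormalGroups`; namespace `Literature.RingTheory.FormalGroups`.  Two DEFINITIONS
(`lazardPoly R n = C_n(X₀,X₁)`, `typProjInt p m` — the integral twin of `typProj`) + fully proved theorems; no named fact, no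
instance, no `sorry`.  `F_V = univTypicalLaw p` over `ℤ[V]` (`V_{i+1} = X i`), `ι_* F_V = f_V⁻¹(f_V X + f_V Y)`.

The two facts about `F_V` that drive the degree-by-degree universality argument:

* `le_order_map_sub_map_univTypicalLaw` — **isobaric truncation**: if two ring maps `φ, φ' : ℤ[V] → B` agree on the `X k`
  with `p^{k+1} ≤ m`, then `φ_* F_V ≡ φ'_* F_V (mod deg m+1)` (the coefficients of `F_V` in degree `≤ m` only involve those
  `X k`; proof: `π_m f_V ≡ f_V (mod deg m+1)` and `f_V` is injective modulo degrees).
* `le_order_map_sub_map_add_univTypicalLaw` — **the `V_k`-linear term**: with `n = p^{k+1}`, if `φ' = φ` except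
  `φ'(X k) = φ(X k) + t`, then `φ'_* F_V ≡ φ_* F_V - t · C_n (mod deg n+1)`, where
  `C_n = p⁻¹((X₀+X₁)^n - X₀^n - X₁^n) = lazardPoly` (`a_{k+1} ≡ X_k/p` modulo `X_0,…,X_{k-1}`, so
  `F_V ≡ π F_V - (X_k/p)((X₀+X₁)^n - X₀^n - X₁^n)`).

## References
* [Hazewinkel1978] M. Hazewinkel, *Formal Groups and Applications* (1978), §15.2 (15.2.2)–(15.2.6), §5.7.
* [Lazard1955] M. Lazard, Bull. SMF 83 (1955), Lemme 3 and (3.3) (`C_q`, `B_q = (x+y)^q - x^q - y^q`).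
-/

noncomputable section

namespace Literature.RingTheory.FormalGroups

open MvPolynomial Finset

/-! ## §1 Lazard's polynomial `C_n(X₀,X₁) = Σ_{0<s<n} b_{n,s} X₀^s X₁^{n-s}` -/

section LazardPoly

variable (R : Type*) [CommRing R]

/-- Lazard's `C_n(X₀,X₁) = Σ_{0<s<n} b_{n,s} X₀^s X₁^{n-s}` (`= d_n⁻¹((X₀+X₁)^n - X₀^n - X₁^n)`) as a power series over `R`.
[cite: Lazard1955, Lemme 3] -/
def lazardPoly (n : ℕ) : MvPowerSeries (Fin 2) R :=
  ∑ s ∈ Finset.Ioo 0 n, (lazardCoeff n s : R) • ((MvPowerSeries.X 0) ^ s * (MvPowerSeries.X 1) ^ (n - s))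

variable {R}

/-- `C_n` is compatible with base change. [cite: Lazard1955, Lemme 3] -/
theorem map_lazardPoly {S : Type*} [CommRing S] (φ : R →+* S) (n : ℕ) :
    MvPowerSeries.map φ (lazardPoly R n) = lazardPoly S n := by
  simp [lazardPoly, map_sum, MvPowerSeries.map_X, map_natCast, Algebra.smul_def]

/-- `C_n ≡ 0 (mod deg n)` (it is homogeneous of degree `n`). [cite: Lazard1955, Lemme 3] -/
theorem le_order_lazardPoly (n : ℕ) : (n : ℕ∞) ≤ (lazardPoly R n).order := by
  refine natCast_le_order_sum _ fun s hs => ?_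
  rw [Finset.mem_Ioo] at hs
  refine le_trans ?_ MvPowerSeries.le_order_smul
  have h0 := natCast_le_order_pow (MvPowerSeries.constantCoeff_X (0 : Fin 2) (R := R)) s
  have h1 := natCast_le_order_pow (MvPowerSeries.constantCoeff_X (1 : Fin 2) (R := R)) (n - s)
  have h := natCast_add_le_order_mul h0 h1
  rwa [show s + (n - s) = n by omega] at h

/-- `d_{p^e} = p` for `e ≥ 1`. [cite: Lazard1955, §III (3.3)] -/
theorem cocycleGcd_prime_pow {p : ℕ} (hp : p.Prime) {e : ℕ} (he : 1 ≤ e) : cocycleGcd (p ^ e) = p := by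
  unfold cocycleGcd
  rw [Choose.gcd_choose_eq_minFac_of_isPrimePow ((hp.prime.isPrimePow).pow (by omega)), Nat.pow_minFac (by omega),
    hp.minFac_eq]

/-- **`p · C_{p^e} = (X₀+X₁)^{p^e} - X₀^{p^e} - X₁^{p^e}`** (`e ≥ 1`). [cite: Lazard1955, §III (3.3)] -/
theorem natCast_smul_lazardPoly_prime_pow {p : ℕ} (hp : p.Prime) {e : ℕ} (he : 1 ≤ e) :
    (p : R) • lazardPoly R (p ^ e) =
      (MvPowerSeries.X 0 + MvPowerSeries.X 1) ^ p ^ e - MvPowerSeries.X 0 ^ p ^ e - MvPowerSeries.X 1 ^ p ^ e := by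
  set n := p ^ e with hn
  have hn2 : 2 ≤ n := le_trans hp.two_le (by rw [hn]; exact Nat.le_self_pow (by omega) p)
  rw [lazardPoly, Finset.smul_sum, add_pow]
  have hsplit : Finset.range (n + 1) = insert 0 (insert n (Finset.Ioo 0 n)) := by
    ext s; simp [Finset.mem_Ioo]; omega
  rw [hsplit, Finset.sum_insert (by simp; omega), Finset.sum_insert (by simp)]
  simp only [pow_zero, Nat.sub_zero, one_mul, Nat.choose_zero_right, Nat.cast_one, mul_one, Nat.sub_self, pow_zero,
    Nat.choose_self]
  have e1 : MvPowerSeries.X 1 ^ n + (MvPowerSeries.X 0 ^ n + ∑ s ∈ Finset.Ioo 0 n,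
      MvPowerSeries.X 0 ^ s * MvPowerSeries.X 1 ^ (n - s) * ((n.choose s : ℕ) : MvPowerSeries (Fin 2) R)) -
      MvPowerSeries.X 0 ^ n - MvPowerSeries.X 1 ^ n =
      ∑ s ∈ Finset.Ioo 0 n, MvPowerSeries.X 0 ^ s * MvPowerSeries.X 1 ^ (n - s) * ((n.choose s : ℕ) : MvPowerSeries (Fin 2) R) := by
    ring
  rw [e1]
  refine Finset.sum_congr rfl fun s hs => ?_
  rw [Finset.mem_Ioo] at hs
  rw [smul_smul, ← Nat.cast_mul, mul_comm (p : ℕ), ← cocycleGcd_prime_pow hp he, ← hn,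
    lazardCoeff_mul_cocycleGcd (by omega) (by omega), Nat.cast_smul_eq_nsmul, nsmul_eq_mul, mul_comm]

end LazardPoly

/-! ## §2 Transfer of congruences along `ι : ℤ[V] ↪ ℚ[V]` and along base change -/

section Transfer

variable {A K : Type*} [CommRing A] [CommRing K] {τ : Type*}

/-- Congruences descend along an injective coefficient map. [cite: Lazard1955, §I Lemme 1] -/
theorem le_order_of_le_order_map (ι : A →+* K) (hι : Function.Injective ι) {N : ℕ} {U : MvPowerSeries τ A}
    (h : (N : ℕ∞) ≤ (MvPowerSeries.map ι U).order) : (N : ℕ∞) ≤ U.order := by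
  rw [natCast_le_order_iff] at h ⊢
  intro d hd
  apply hι
  rw [← MvPowerSeries.coeff_map, h d hd, map_zero]

/-- Congruences are preserved by base change (`u.f` for a ring map `u`). [cite: Lazard1955, §II] -/
theorem le_order_map_of_le_order (φ : A →+* K) {N : ℕ} {U : MvPowerSeries τ A} (h : (N : ℕ∞) ≤ U.order) :
    (N : ℕ∞) ≤ (MvPowerSeries.map φ U).order :=
  le_trans h (MvPowerSeries.le_order_map _)

end Transfer

/-! ## §3 Substituting into congruent outer series -/

section Outer

variable {K : Type*} [CommRing K] {τ : Type*}

/-- If `ψ ≡ 0 (mod deg N)` and `Q(0) = 0` then `ψ(Q) ≡ 0 (mod deg N)`. [cite: Lazard1955, §I Lemme 1] -/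
theorem le_order_psubst_of_le_order {N : ℕ} {ψ : PowerSeries K} (hψ : (N : ℕ∞) ≤ MvPowerSeries.order ψ)
    {Q : MvPowerSeries τ K} (hQ : MvPowerSeries.constantCoeff Q = 0) :
    (N : ℕ∞) ≤ (PowerSeries.subst Q ψ).order := by
  rw [PowerSeries.subst_def]
  refine le_trans ?_ (MvPowerSeries.le_order_subst (PowerSeries.HasSubst.const (PowerSeries.HasSubst.of_constantCoeff_zero hQ)) ψ)
  rw [iInf_const]
  refine le_trans hψ (le_mul_of_one_le_left (by simp) ?_)
  exact (MvPowerSeries.one_le_order_iff_constCoeff_eq_zero).mpr hQ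

end Outer

/-! ## §4 Truncations of `F_V`: the integral projections `π_m` -/

section Proj

variable (p : ℕ) [hp : Fact p.Prime]

/-- The integral projection `π_m : ℤ[V] → ℤ[V]`, `X k ↦ X k` if `p^{k+1} ≤ m`, else `0`. [cite: Hazewinkel1978, §15.2] -/
def typProjInt (m : ℕ) : MvPolynomial ℕ ℤ →+* MvPolynomial ℕ ℤ :=
  (MvPolynomial.aeval fun k => if p ^ (k + 1) ≤ m then (X k : MvPolynomial ℕ ℤ) else 0).toRingHom

omit hp in
/-- `ι ∘ π_m = π_m ∘ ι`. [cite: Hazewinkel1978, §15.2] -/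
theorem map_comp_typProjInt (m : ℕ) :
    (MvPolynomial.map (Int.castRingHom ℚ) : MvPolynomial ℕ ℤ →+* MvPolynomial ℕ ℚ).comp (typProjInt p m) =
      (typProj p m).toRingHom.comp (MvPolynomial.map (Int.castRingHom ℚ)) := by
  refine MvPolynomial.ringHom_ext (fun r => by simp [typProjInt, typProj]) (fun k => ?_)
  by_cases h : p ^ (k + 1) ≤ m
  · simp [typProjInt, typProj, h]
  · simp [typProjInt, typProj, h]

omit hp in
/-- Two ring maps out of `ℤ[V]` agreeing on the `X k` with `p^{k+1} ≤ m` agree after `π_m`. [cite: Hazewinkel1978, §15.2] -/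
theorem comp_typProjInt_eq {B : Type*} [CommRing B] {m : ℕ} {φ φ' : MvPolynomial ℕ ℤ →+* B}
    (h : ∀ k, p ^ (k + 1) ≤ m → φ (X k) = φ' (X k)) : φ.comp (typProjInt p m) = φ'.comp (typProjInt p m) := by
  refine MvPolynomial.ringHom_ext (fun r => by simp [typProjInt]) (fun k => ?_)
  by_cases hk : p ^ (k + 1) ≤ m
  · simp [typProjInt, hk, h k hk]
  · simp [typProjInt, hk]

/-- **`π_m F_V ≡ F_V (mod deg m+1)` over `ℚ[V]`**: with `f^π = π_m f_V ≡ f_V`, `f_V(πF) ≡ f^π(πF) = f^π X + f^π Y ≡ f X + f Y = f_V(F)`,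
and `f_V` is injective modulo degrees. [cite: Hazewinkel1978, §15.2 (15.2.4)] -/
theorem le_order_map_typProj_logLawSeries_sub (m : ℕ) :
    ((m + 1 : ℕ) : ℕ∞) ≤ (MvPowerSeries.map (typProj p m).toRingHom (logLawSeries (typLog p) (coeff_one_typLog p)) -
      logLawSeries (typLog p) (coeff_one_typLog p)).order := by
  set f := typLog p with hf
  have hf0 : PowerSeries.constantCoeff f = 0 := constantCoeff_typLog p
  have hf1 : PowerSeries.coeff 1 f = 1 := coeff_one_typLog p
  set π : MvPolynomial ℕ ℚ →+* MvPolynomial ℕ ℚ := (typProj p m).toRingHom with hπ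
  set F := logLawSeries f hf1 with hF
  set fπ := PowerSeries.map π f with hfπ
  have hF0 : MvPowerSeries.constantCoeff F = 0 := by
    have h := constantCoeff_logLawSeries_subst f hf1 hf0 (a := (MvPowerSeries.X : Fin 2 → MvPowerSeries (Fin 2) _))
      (fun i => MvPowerSeries.constantCoeff_X i)
    rwa [MvPowerSeries.subst_self] at h
  have hFπ0 : MvPowerSeries.constantCoeff (MvPowerSeries.map π F) = 0 := by
    rw [MvPowerSeries.constantCoeff_map, hF0, map_zero]
  have hlogF : PowerSeries.subst F f = PowerSeries.subst (MvPowerSeries.X 0) f + PowerSeries.subst (MvPowerSeries.X 1) f := by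
    have h := log_subst_logLawSeries f hf1 hf0 (a := (MvPowerSeries.X : Fin 2 → MvPowerSeries (Fin 2) _))
      (fun i => MvPowerSeries.constantCoeff_X i)
    rwa [MvPowerSeries.subst_self] at h
  -- `f - fπ ≡ 0 (mod deg m+1)`
  have hffπ : ((m + 1 : ℕ) : ℕ∞) ≤ MvPowerSeries.order (f - fπ) := by
    refine natCast_le_order_of_coeff_eq_zero fun i hi => ?_
    rw [map_sub, hfπ, coeff_map_typProj_typLog p (by omega), sub_self]
  -- `fπ(πF) = fπ X₀ + fπ X₁`
  have hlogπ : PowerSeries.subst (MvPowerSeries.map π F) fπ =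
      PowerSeries.subst (MvPowerSeries.X 0) fπ + PowerSeries.subst (MvPowerSeries.X 1) fπ := by
    have h := congrArg (MvPowerSeries.map π) hlogF
    rwa [PowerSeries.map_subst (PowerSeries.HasSubst.of_constantCoeff_zero hF0), map_add,
      PowerSeries.map_subst (PowerSeries.HasSubst.X 0), PowerSeries.map_subst (PowerSeries.HasSubst.X 1),
      MvPowerSeries.map_X, MvPowerSeries.map_X] at h
  -- assemble `f(πF) ≡ f(F)`
  have key : ((m + 1 : ℕ) : ℕ∞) ≤ (PowerSeries.subst (MvPowerSeries.map π F) f - PowerSeries.subst F f).order := by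
    have e1 : PowerSeries.subst (MvPowerSeries.map π F) f - PowerSeries.subst F f =
        PowerSeries.subst (MvPowerSeries.map π F) (f - fπ) -
          (PowerSeries.subst (MvPowerSeries.X 0) (f - fπ) + PowerSeries.subst (MvPowerSeries.X 1) (f - fπ)) := by
      rw [PowerSeries.subst_sub (PowerSeries.HasSubst.of_constantCoeff_zero hFπ0),
        PowerSeries.subst_sub (PowerSeries.HasSubst.X 0), PowerSeries.subst_sub (PowerSeries.HasSubst.X 1), hlogπ, hlogF]
      ring
    rw [e1]
    exact natCast_le_order_sub (le_order_psubst_of_le_order hffπ hFπ0)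
      (natCast_le_order_add (le_order_psubst_of_le_order hffπ (MvPowerSeries.constantCoeff_X 0))
        (le_order_psubst_of_le_order hffπ (MvPowerSeries.constantCoeff_X 1)))
  exact le_order_sub_of_log_subst f hf1 hf0 hFπ0 hF0 key

/-- **Isobaric truncation of `F_V` over `ℤ[V]`**: `π_m F_V ≡ F_V (mod deg m+1)`. [cite: Hazewinkel1978, §15.2 (15.2.4)] -/
theorem le_order_map_typProjInt_univTypicalLaw_sub (m : ℕ) :
    ((m + 1 : ℕ) : ℕ∞) ≤ (MvPowerSeries.map (typProjInt p m) (univTypicalLaw p).toPowerSeries -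
      (univTypicalLaw p).toPowerSeries).order := by
  refine le_order_of_le_order_map (MvPolynomial.map (Int.castRingHom ℚ)) (MvPolynomial.map_injective _ Int.cast_injective) ?_
  rw [map_sub, MvPowerSeries.map_map, map_comp_typProjInt, ← MvPowerSeries.map_map, map_univTypicalLaw_toPowerSeries]
  exact le_order_map_typProj_logLawSeries_sub p m

/-- **Base changes agreeing on the visible variables give congruent laws**: if `φ(X k) = φ'(X k)` whenever `p^{k+1} ≤ m` then
`φ_* F_V ≡ φ'_* F_V (mod deg m+1)`. [cite: Hazewinkel1978, §15.2 (15.2.4)] -/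
theorem le_order_map_sub_map_univTypicalLaw {B : Type*} [CommRing B] {m : ℕ} {φ φ' : MvPolynomial ℕ ℤ →+* B}
    (h : ∀ k, p ^ (k + 1) ≤ m → φ (X k) = φ' (X k)) :
    ((m + 1 : ℕ) : ℕ∞) ≤ (((univTypicalLaw p).map φ).toPowerSeries - ((univTypicalLaw p).map φ').toPowerSeries).order := by
  set H := (univTypicalLaw p).toPowerSeries with hH
  have hc := comp_typProjInt_eq p h
  have e1 : ((univTypicalLaw p).map φ).toPowerSeries - ((univTypicalLaw p).map φ').toPowerSeries =
      MvPowerSeries.map φ (H - MvPowerSeries.map (typProjInt p m) H) -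
        MvPowerSeries.map φ' (H - MvPowerSeries.map (typProjInt p m) H) := by
    simp only [FormalGroup.map_toPowerSeries, map_sub, MvPowerSeries.map_map, hc, ← hH]
    ring
  rw [e1]
  have hH' := natCast_le_order_sub_comm (le_order_map_typProjInt_univTypicalLaw_sub p m)
  exact natCast_le_order_sub (le_order_map_of_le_order φ hH') (le_order_map_of_le_order φ' hH')

end Proj

/-! ## §5 The `V_k`-linear term of `F_V` in degree `n = p^{k+1}` -/

section Linear

variable (p : ℕ) [hp : Fact p.Prime]

/-- **`π F_V ≡ F_V + X_k · C_n (mod deg n+1)`** over `ℚ[V]`, `n = p^{k+1}`, `π = π_{n-1}` (which kills `X_k, X_{k+1}, …`):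
from `f_V ≡ f^π + (X_k/p) Xⁿ`, `f_V(πF) ≡ f^π(πF) + (X_k/p)(X₀+X₁)ⁿ = f X₀ + f X₁ - (X_k/p)(X₀ⁿ + X₁ⁿ) + (X_k/p)(X₀+X₁)ⁿ
 = f_V(F) + X_k C_n ≡ f_V(F + X_k C_n)`, and `f_V` is injective modulo degrees. [cite: Hazewinkel1978, §15.2 (15.2.6)] -/
theorem le_order_map_typProj_logLawSeries_sub_add (k : ℕ) :
    ((p ^ (k + 1) + 1 : ℕ) : ℕ∞) ≤
      (MvPowerSeries.map (typProj p (p ^ (k + 1) - 1)).toRingHom (logLawSeries (typLog p) (coeff_one_typLog p)) -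
        (logLawSeries (typLog p) (coeff_one_typLog p) +
          MvPowerSeries.C (X k : MvPolynomial ℕ ℚ) * lazardPoly (MvPolynomial ℕ ℚ) (p ^ (k + 1)))).order := by
  set n := p ^ (k + 1) with hn
  have hn2 : 2 ≤ n := le_trans hp.out.two_le (by rw [hn]; exact Nat.le_self_pow (by omega) p)
  set f := typLog p with hf
  have hf0 : PowerSeries.constantCoeff f = 0 := constantCoeff_typLog p
  have hf1 : PowerSeries.coeff 1 f = 1 := coeff_one_typLog p
  set π : MvPolynomial ℕ ℚ →+* MvPolynomial ℕ ℚ := (typProj p (n - 1)).toRingHom with hπ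
  set F := logLawSeries f hf1 with hF
  set fπ := PowerSeries.map π f with hfπ
  set c : MvPolynomial ℕ ℚ := (p : ℚ)⁻¹ • X k with hc
  set Cn : MvPowerSeries (Fin 2) (MvPolynomial ℕ ℚ) := lazardPoly (MvPolynomial ℕ ℚ) n with hCn
  have hF0 : MvPowerSeries.constantCoeff F = 0 := by
    have h := constantCoeff_logLawSeries_subst f hf1 hf0 (a := (MvPowerSeries.X : Fin 2 → MvPowerSeries (Fin 2) _))
      (fun i => MvPowerSeries.constantCoeff_X i)
    rwa [MvPowerSeries.subst_self] at h
  have hFπ0 : MvPowerSeries.constantCoeff (MvPowerSeries.map π F) = 0 := by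
    rw [MvPowerSeries.constantCoeff_map, hF0, map_zero]
  have hlogF : PowerSeries.subst F f = PowerSeries.subst (MvPowerSeries.X 0) f + PowerSeries.subst (MvPowerSeries.X 1) f := by
    have h := log_subst_logLawSeries f hf1 hf0 (a := (MvPowerSeries.X : Fin 2 → MvPowerSeries (Fin 2) _))
      (fun i => MvPowerSeries.constantCoeff_X i)
    rwa [MvPowerSeries.subst_self] at h
  have hlogπ : PowerSeries.subst (MvPowerSeries.map π F) fπ =
      PowerSeries.subst (MvPowerSeries.X 0) fπ + PowerSeries.subst (MvPowerSeries.X 1) fπ := by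
    have h := congrArg (MvPowerSeries.map π) hlogF
    rwa [PowerSeries.map_subst (PowerSeries.HasSubst.of_constantCoeff_zero hF0), map_add,
      PowerSeries.map_subst (PowerSeries.HasSubst.X 0), PowerSeries.map_subst (PowerSeries.HasSubst.X 1),
      MvPowerSeries.map_X, MvPowerSeries.map_X] at h
  -- (1) `f - fπ - c Xⁿ ≡ 0 (mod deg n+1)`
  set g : PowerSeries (MvPolynomial ℕ ℚ) := f - fπ - PowerSeries.C c * PowerSeries.X ^ n with hg
  have hgord : ((n + 1 : ℕ) : ℕ∞) ≤ MvPowerSeries.order g := by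
    refine natCast_le_order_of_coeff_eq_zero fun i hi => ?_
    rw [hg, map_sub, map_sub, hfπ, hf, coeff_typLog_sub_map_typProj p (by omega), PowerSeries.coeff_C_mul,
      PowerSeries.coeff_X_pow]
    split_ifs with h
    · rw [hc, mul_one, Algebra.smul_def, MvPolynomial.algebraMap_eq, sub_self]
    · rw [mul_zero, sub_zero]
  have hgsubst : ∀ Q : MvPowerSeries (Fin 2) (MvPolynomial ℕ ℚ), MvPowerSeries.constantCoeff Q = 0 →
      PowerSeries.subst Q g = PowerSeries.subst Q f - PowerSeries.subst Q fπ - MvPowerSeries.C c * Q ^ n := by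
    intro Q hQ
    have hQs := PowerSeries.HasSubst.of_constantCoeff_zero hQ
    rw [hg, PowerSeries.subst_sub hQs, PowerSeries.subst_sub hQs, PowerSeries.subst_mul hQs, PowerSeries.subst_pow hQs,
      PowerSeries.subst_C, PowerSeries.subst_X hQs]
  -- (3) `(πF)ⁿ ≡ (X₀+X₁)ⁿ (mod deg n+1)`
  have hpow : ((n + 1 : ℕ) : ℕ∞) ≤ ((MvPowerSeries.map π F) ^ n - (MvPowerSeries.X 0 + MvPowerSeries.X 1) ^ n).order := by
    have h2 : ((2 : ℕ) : ℕ∞) ≤ (MvPowerSeries.map π F - (MvPowerSeries.X 0 + MvPowerSeries.X 1)).order := by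
      have h := le_order_map_of_le_order π (two_le_order_logLawSeries_sub f hf1 hf0)
      rwa [map_sub, map_add, MvPowerSeries.map_X, MvPowerSeries.map_X] at h
    have h := le_order_pow_sub_pow hFπ0 (by simp) h2 n (by omega)
    rwa [show 2 + n - 1 = n + 1 by omega] at h
  -- (7) `Cn ≡ 0 (mod deg n)` and the first-order expansion of `f(F + X_k Cn)`
  have hCn0 : MvPowerSeries.constantCoeff (MvPowerSeries.C (X k : MvPolynomial ℕ ℚ) * Cn) = 0 := by
    have h := natCast_le_order_mul_left (MvPowerSeries.C (X k : MvPolynomial ℕ ℚ)) (le_order_lazardPoly (R := MvPolynomial ℕ ℚ) n)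
    have h' := (natCast_le_order_iff.mp h) 0 (by simp; omega)
    rwa [MvPowerSeries.coeff_zero_eq_constantCoeff_apply] at h'
  have hFC0 : MvPowerSeries.constantCoeff (F + MvPowerSeries.C (X k : MvPolynomial ℕ ℚ) * Cn) = 0 := by
    rw [map_add, hF0, hCn0, add_zero]
  have h7 : ((n + 1 : ℕ) : ℕ∞) ≤ (PowerSeries.subst (F + MvPowerSeries.C (X k : MvPolynomial ℕ ℚ) * Cn) f -
      PowerSeries.subst F f - MvPowerSeries.C (X k : MvPolynomial ℕ ℚ) * Cn).order := by
    have h := le_order_psubst_sub_psubst_sub hf0 hf1 (by omega : 1 ≤ n) hFC0 hF0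
      (by rw [add_sub_cancel_left]; exact natCast_le_order_mul_left _ (le_order_lazardPoly n))
    rwa [add_sub_cancel_left] at h
  -- (6) the main congruence `f(πF) ≡ f(F) + X_k Cn (mod deg n+1)`
  have hpc : (p : MvPolynomial ℕ ℚ) * c = X k := by
    rw [hc, Algebra.smul_def, MvPolynomial.algebraMap_eq, ← mul_assoc, ← map_natCast MvPolynomial.C p, ← map_mul,
      mul_inv_cancel₀ (by exact_mod_cast hp.out.ne_zero : (p : ℚ) ≠ 0), map_one, one_mul]
  have hCnp : MvPowerSeries.C (X k : MvPolynomial ℕ ℚ) * Cn =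
      MvPowerSeries.C c * ((MvPowerSeries.X 0 + MvPowerSeries.X 1) ^ n - MvPowerSeries.X 0 ^ n - MvPowerSeries.X 1 ^ n) := by
    rw [hCn, hn, ← natCast_smul_lazardPoly_prime_pow (R := MvPolynomial ℕ ℚ) hp.out (by omega : 1 ≤ k + 1), ← hn,
      MvPowerSeries.smul_eq_C_mul, ← mul_assoc, ← map_mul, mul_comm c, hpc]
  have h6 : ((n + 1 : ℕ) : ℕ∞) ≤ (PowerSeries.subst (MvPowerSeries.map π F) f -
      (PowerSeries.subst F f + MvPowerSeries.C (X k : MvPolynomial ℕ ℚ) * Cn)).order := by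
    have e1 : PowerSeries.subst (MvPowerSeries.map π F) f - (PowerSeries.subst F f + MvPowerSeries.C (X k : MvPolynomial ℕ ℚ) * Cn) =
        PowerSeries.subst (MvPowerSeries.map π F) g
          - (PowerSeries.subst (MvPowerSeries.X 0) g + PowerSeries.subst (MvPowerSeries.X 1) g)
          + MvPowerSeries.C c * ((MvPowerSeries.map π F) ^ n - (MvPowerSeries.X 0 + MvPowerSeries.X 1) ^ n) := by
      rw [hgsubst _ hFπ0, hgsubst _ (MvPowerSeries.constantCoeff_X 0), hgsubst _ (MvPowerSeries.constantCoeff_X 1),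
        hlogπ, hlogF, hCnp]
      ring
    rw [e1]
    refine natCast_le_order_add (natCast_le_order_sub (le_order_psubst_of_le_order hgord hFπ0)
      (natCast_le_order_add (le_order_psubst_of_le_order hgord (MvPowerSeries.constantCoeff_X 0))
        (le_order_psubst_of_le_order hgord (MvPowerSeries.constantCoeff_X 1)))) ?_
    exact natCast_le_order_mul_left _ hpow
  -- (8) conclude by injectivity of `f`
  have key : ((n + 1 : ℕ) : ℕ∞) ≤ (PowerSeries.subst (MvPowerSeries.map π F) f -
      PowerSeries.subst (F + MvPowerSeries.C (X k : MvPolynomial ℕ ℚ) * Cn) f).order := by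
    have e1 : PowerSeries.subst (MvPowerSeries.map π F) f - PowerSeries.subst (F + MvPowerSeries.C (X k : MvPolynomial ℕ ℚ) * Cn) f =
        (PowerSeries.subst (MvPowerSeries.map π F) f - (PowerSeries.subst F f + MvPowerSeries.C (X k : MvPolynomial ℕ ℚ) * Cn)) -
        (PowerSeries.subst (F + MvPowerSeries.C (X k : MvPolynomial ℕ ℚ) * Cn) f - PowerSeries.subst F f -
          MvPowerSeries.C (X k : MvPolynomial ℕ ℚ) * Cn) := by ring
    rw [e1]
    exact natCast_le_order_sub h6 h7
  exact le_order_sub_of_log_subst f hf1 hf0 hFπ0 hFC0 key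

/-- The same over `ℤ[V]`: `π F_V ≡ F_V + X_k C_n (mod deg n+1)`, `n = p^{k+1}`, `π = typProjInt p (n-1)`.
[cite: Hazewinkel1978, §15.2 (15.2.6)] -/
theorem le_order_map_typProjInt_univTypicalLaw_sub_add (k : ℕ) :
    ((p ^ (k + 1) + 1 : ℕ) : ℕ∞) ≤
      (MvPowerSeries.map (typProjInt p (p ^ (k + 1) - 1)) (univTypicalLaw p).toPowerSeries -
        ((univTypicalLaw p).toPowerSeries +
          MvPowerSeries.C (X k : MvPolynomial ℕ ℤ) * lazardPoly (MvPolynomial ℕ ℤ) (p ^ (k + 1)))).order := by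
  refine le_order_of_le_order_map (MvPolynomial.map (Int.castRingHom ℚ)) (MvPolynomial.map_injective _ Int.cast_injective) ?_
  rw [map_sub, map_add, map_mul, MvPowerSeries.map_map, map_comp_typProjInt, ← MvPowerSeries.map_map,
    map_univTypicalLaw_toPowerSeries, map_lazardPoly, MvPowerSeries.map_C, MvPolynomial.map_X]
  exact le_order_map_typProj_logLawSeries_sub_add p k

/-- **The `V_k`-linear term of `F_V`** (`n = p^{k+1}`): if `φ, φ' : ℤ[V] → B` agree except `φ'(X k) = φ(X k) + t`, then
`φ'_* F_V ≡ φ_* F_V - t · C_n (mod deg n+1)`. [cite: Hazewinkel1978, §15.2 (15.2.6)] -/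
theorem le_order_map_sub_map_add_univTypicalLaw {B : Type*} [CommRing B] (k : ℕ) {φ φ' : MvPolynomial ℕ ℤ →+* B} (t : B)
    (hX : ∀ j, j ≠ k → φ' (X j) = φ (X j)) (hk : φ' (X k) = φ (X k) + t) :
    ((p ^ (k + 1) + 1 : ℕ) : ℕ∞) ≤ (((univTypicalLaw p).map φ').toPowerSeries -
      (((univTypicalLaw p).map φ).toPowerSeries - MvPowerSeries.C t * lazardPoly B (p ^ (k + 1)))).order := by
  set n := p ^ (k + 1) with hn
  set H := (univTypicalLaw p).toPowerSeries with hH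
  set π := typProjInt p (n - 1) with hπ
  -- `φ ∘ π = φ' ∘ π`
  have hc : φ'.comp π = φ.comp π := by
    refine comp_typProjInt_eq p fun j hj => hX j ?_
    rintro rfl
    have : p ^ (j + 1) ≤ p ^ (j + 1) - 1 := by rw [hn] at hj; exact hj
    have hpos : 0 < p ^ (j + 1) := pow_pos hp.out.pos _
    omega
  have hmain := le_order_map_typProjInt_univTypicalLaw_sub_add p k
  rw [← hn, ← hH, ← hπ] at hmain
  -- `φ'_* H ≡ (φ'π)_* H - φ'(X_k) Cn`, `φ_* H ≡ (φπ)_* H - φ(X_k) Cn`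
  have e1 : ((univTypicalLaw p).map φ').toPowerSeries - (((univTypicalLaw p).map φ).toPowerSeries - MvPowerSeries.C t * lazardPoly B n) =
      - MvPowerSeries.map φ' (MvPowerSeries.map π H - (H + MvPowerSeries.C (X k : MvPolynomial ℕ ℤ) * lazardPoly _ n))
      + MvPowerSeries.map φ (MvPowerSeries.map π H - (H + MvPowerSeries.C (X k : MvPolynomial ℕ ℤ) * lazardPoly _ n)) := by
    simp only [FormalGroup.map_toPowerSeries, map_sub, map_add, map_mul, MvPowerSeries.map_map, hc, ← hH,
      map_lazardPoly, MvPowerSeries.map_C, hk, map_add]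
    ring
  rw [e1]
  refine natCast_le_order_add ?_ (le_order_map_of_le_order φ hmain)
  rw [MvPowerSeries.order_neg]
  exact le_order_map_of_le_order φ' hmain

end Linear

end Literature.RingTheory.FormalGroups
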